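import Literature.IUT.HodgeArakelov.IotaInvariantThetaInftyOrbitFinite
import Literature.IUT.HodgeArakelov.EtaleThetaDataOfSettingCyclotomeTower

/-!
# [IUTchII] Prop 2.2 (ii) «respectively» clause AT THE MODEL — BOTH binders (hfix) and (hdiv) discharged

S. Mochizuki, *Inter-universal Teichmüller theory II*, kurims manuscript (Dec. 2020), §2 Prop. 2.2 (ii) p. 66
l. 56–61: "determines a specific … `μ (= M^μ_TM(Π_v))`-orbit … `∞θ^ι(Π_v) ⊆ ∞θ(Π_v)` within each
`{(l·ℤ) × μ}`-orbit" [claim: Mochizuki2012, status: disputed]. abc-iut cell, layer L6, node IUTchII:Prop2.2(ii),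
sub-DAG row Prop-22.ii.r13a. The clause was typed as `IotaInvariantTheta'.InftyClause` and proved at the model
`D := etaleThetaDataOfSetting'` modulo (hfix) + (hdiv) (`IotaInvariantThetaInftyModel.lean`, abc-iut-w5-d187,
p414969); (hfix) was discharged from the cyclotome tower by abc-iut-w4-d041 (`hfix_of_cyclotomeTower`,
`EtaleThetaDataOfSettingCyclotomeTower.lean`, p419525); (hdiv) from [EtTh] Prop. 1.5 (iii) by abc-iut-w5-d187
(`hdiv_etaleThetaDataOfSetting'`, `IotaInvariantThetaInftyOrbitFinite.lean`). THIS FILE is the one-line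
assembly: **`inftyClause_of_cyclotomeTower_of_prop15iii`** — the clause holds for every `IotaInvariantTheta'` datum
over the model, modulo ONLY the named inputs: the origin guard `IsEtThOrigin` (F-2498), a cyclotome tower
`CyclotomeTower` ([EtTh] Def. 2.13 / Cor. 2.19 (ii); L2 data, abc-iut-L2-t8), `Prop15iii` (F-0591), and the structural
topological input "`Δ_Θ` compact, `(Π^tp_X)^Θ` Hausdorff" ([EtTh] p. 12 "abelian profinite groups"). Proof-only; nothing
of [IUTchII]/[EtTh] asserted; no side taken on [IUTchIII] Cor. 3.12.
-/

namespace Literature.IUT.HodgeArakelov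

open Literature.AnabelianGeometry.EtaleTheta Literature.AnabelianGeometry.SemiGraphs
open EtaleThetaDataOfSetting

noncomputable section

namespace EtaleThetaDataOfSetting

variable {p : ℕ} [Fact p.Prime] {D : Literature.AnabelianGeometry.EtaleTheta.ThetaSetting p}
  {E : D.EtaleThetaData} {l : ℕ} (C : E.DoubleUnderline l)

/-- **(hdiv) at the model from a cyclotome tower** (the tower supplies the identifications `μ_M ≅ (l·Δ_Θ) ⊗ ℤ/M`
at every level, `CyclotomeTower.modAll`). [claim: Mochizuki2012, status: disputed]
(IUTchII §2 Prop 2.2 (ii), kurims p.66) -/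
theorem hdiv_of_cyclotomeTower_of_prop15iii (hO : D.IsEtThOrigin) {Es : Set ℕ+} (τ : D.CyclotomeTower l Es)
    (hΔ : IsCompact (D.DeltaTheta : Set D.GtpTheta)) [T2Space D.GtpTheta] (hC : D.Compat) (hS : D.Sec2Hyps)
    (h15 : ThetaSetting.Prop15iii E hC) (hchar : PiYddCharacteristic C) (S : BadPlaceSetting.{0})
    (eS : (Pi C) ≃ₜ* S.PiX) (hl : S.l = l) :
    ∀ t ∈ (etaleThetaDataOfSetting' C hC hS hchar S.toThetaSetting eS hl).theta, ∀ N : ℕ, 0 < N →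
      ∃ x : (coh C).lim, N • x = (coh C).toLim ⊤ t :=
  hdiv_etaleThetaDataOfSetting' C hC hS hO hΔ (fun M => τ.modAll M) h15 hchar S eS hl

/-- **IUTchII:Prop2.2(ii) «respectively» clause AT THE MODEL, (hfix) AND (hdiv) DISCHARGED**: `InftyClause` —
`∞θ^ι(Π_v)` is nonempty, is ONE `μ`-orbit within each `{(l·ℤ) × μ}`-orbit of `∞θ(Π_v)`, and meets every root
level — holds for every `IotaInvariantTheta'` datum over `D := etaleThetaDataOfSetting'`, modulo ONLY: the origin
guard `IsEtThOrigin` (F-2498), a cyclotome tower ([EtTh] Cor. 2.19 (ii), L2 data), [EtTh] Prop. 1.5 (iii)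
(`Prop15iii`, F-0591), and "`Δ_Θ` compact, `(Π^tp_X)^Θ` Hausdorff" ([EtTh] p. 12).
[claim: Mochizuki2012, status: disputed] (IUTchII §2 Prop 2.2 (ii), kurims p.66) -/
theorem inftyClause_of_cyclotomeTower_of_prop15iii (hO : D.IsEtThOrigin) {Es : Set ℕ+}
    (τ : D.CyclotomeTower l Es) (hΔ : IsCompact (D.DeltaTheta : Set D.GtpTheta)) [T2Space D.GtpTheta]
    (hC : D.Compat) (hS : D.Sec2Hyps) (h15 : ThetaSetting.Prop15iii E hC) (hchar : PiYddCharacteristic C)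
    (S : BadPlaceSetting.{0}) (eS : (Pi C) ≃ₜ* S.PiX) (hl : S.l = l) {T : TemperedCoverings S (Pi C)}
    {Dec : SubgraphDecomposition S T (etaleThetaDataOfSetting' C hC hS hchar S.toThetaSetting eS hl)}
    (Θ : IotaInvariantTheta' Dec) : Θ.InftyClause :=
  inftyClause_of_cyclotomeTower C hO τ hC hS hchar S eS hl Θ
    (hdiv_of_cyclotomeTower_of_prop15iii C hO τ hΔ hC hS h15 hchar S eS hl)

end EtaleThetaDataOfSetting

end

end Literature.IUT.HodgeArakelov
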